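import Mathlib
import Summits.PneNP.PneNP.Theorems.LatticeMagicBooleanSosBlindAtConstantFactorDefs
import Literature.Computability.MetaComplexity.RandomScopes
import Literature.Computability.MetaComplexity.RandomCNFResolutionProofs
import Literature.Computability.MetaComplexity.SumOfSquaresProofs

/-!
# PneNP / LatticeMagic — `BooleanSosBlindAtConstantFactor`, line `Sketch`: stub `stub_parity`

Stub file (`--supports stmt-PneNP-2330`) for the crux line `Sketch` (Construction-A road) of
`Summit.PneNP.PneNP.Theses.LatticeMagic.BooleanSosBlindAtConstantFactor`: the combinatorial step
"CNF-unsatisfiable ⇒ XOR-unsatisfiable" consumed by the NO-instance stub. For a family of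
`3`-clauses `C e ∈ kClauses 3 N` (three literals on three DISTINCT variables `< N`) whose CNF
`List.ofFn C` is unsatisfiable, no integer vector `u ∈ ℤ^N` passes every parity check
`Σ_i u_i · [i ∈ scope (C e)] ≡ rhsBit (C e) (mod 2)` (`XorUnsat N me C`, vocabulary of
`LatticeMagicBooleanSosBlindAtConstantFactorDefs.lean`).

Proof (contrapositive): if `u` passed every check, read the parity assignment `σ v := [u_v odd]`.
For a clause `x` all of whose literals are FALSE under `σ`, each variable `v` of a literal `(v, b)`
has `u_v ≡ [¬ b] (mod 2)`, so `Σ_{l ∈ x} u_{l.1} ≡ #{negative literals} ≡ 1 - rhsBit x (mod 2)`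
(`rhsBit x = 1` iff the number of negative literals is even) — the check of `x` fails
(`stubParity_dvd_of_forall_eval_false`, induction on the clause). Since the variables of `C e` are
distinct and `< N`, the check sum of `C e` is exactly this list sum (`stubParity_sum_eq`), so every
clause `C e` has a true literal and `σ` satisfies `List.ofFn C`.

Source: G. Schoenebeck, *Linear level Lasserre lower bounds for certain k-CSPs*, FOCS 2008, §5
("from `k`-XOR to `k`-SAT": any solution of the odd-parity strengthening of a clause satisfies the
clause). Uses only proved tree lemmas (`clauseScope_subset_range`, `nodup_map_fst_of_mem_kClauses`)
and Mathlib.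
-/

set_option linter.dupNamespace false -- summit = sub-problem (D-0017)

namespace Summit.PneNP.PneNP.Theorems.ConA

open Literature.Algebra.EuclideanLattices Literature.Computability.Complexity
  Literature.Computability.MetaComplexity

/-! ## Parity bookkeeping on one clause -/

/-- The sign product `∏_{l ∈ x} litSignZ l` of a clause is `±1`. (helper for stub `stub_parity`) -/
theorem stubParity_prod_litSignZ (x : Clause ℕ) :
    (x.map litSignZ).prod = 1 ∨ (x.map litSignZ).prod = -1 := by
  induction x with
  | nil => exact Or.inl rfl
  | cons l t ih =>
    rw [List.map_cons, List.prod_cons]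
    have hl : litSignZ l = 1 ∨ litSignZ l = -1 := by
      unfold litSignZ; split_ifs <;> simp
    rcases hl with hl | hl <;> rcases ih with h | h <;> rw [hl, h] <;> norm_num

/-- `rhsBit` of a clause with one more literal: a positive head literal leaves it unchanged, a
negative one flips it. (helper for stub `stub_parity`) -/
theorem stubParity_rhsBit_cons (v : ℕ) (b : Bool) (t : Clause ℕ) :
    rhsBit ((v, b) :: t) = if b then rhsBit t else 1 - rhsBit t := by
  rcases stubParity_prod_litSignZ t with h | h <;> cases b <;> simp [rhsBit, litSignZ, h]

/-- The parity count behind "from `k`-XOR to `k`-SAT" (Schoenebeck 2008, §5): if EVERY literal of a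
clause `x` is false under the parity assignment `v ↦ [w v odd]`, then
`Σ_{l ∈ x} w l.1 ≡ 1 - rhsBit x (mod 2)` — so the check `Σ ≡ rhsBit x` fails. (helper for stub
`stub_parity`) -/
theorem stubParity_dvd_of_forall_eval_false (w : ℕ → ℤ) (x : Clause ℕ)
    (hx : ∀ l ∈ x, Literal.eval (fun v => !decide ((2 : ℤ) ∣ w v)) l = false) :
    (2 : ℤ) ∣ (x.map fun l => w l.1).sum + rhsBit x - 1 := by
  induction x with
  | nil => simp [rhsBit]
  | cons l t ih =>
    obtain ⟨v, b⟩ := l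
    have ht := ih fun l hl => hx l (List.mem_cons_of_mem _ hl)
    have hl := hx (v, b) List.mem_cons_self
    simp only [Literal.eval] at hl
    rw [List.map_cons, List.sum_cons, stubParity_rhsBit_cons]
    by_cases hv : (2 : ℤ) ∣ w v
    · cases b
      · simp [hv] at hl
      · simp only [if_true]
        omega
    · cases b
      · simp only [Bool.false_eq_true, if_false]
        omega
      · simp [hv] at hl

/-- Contrapositive form: if the check `Σ_{l ∈ x} w l.1 ≡ rhsBit x (mod 2)` passes, some literal of
`x` is true under the parity assignment `v ↦ [w v odd]`. (helper for stub `stub_parity`) -/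
theorem stubParity_exists_eval_true (w : ℕ → ℤ) (x : Clause ℕ)
    (h : (2 : ℤ) ∣ (x.map fun l => w l.1).sum - rhsBit x) :
    ∃ l ∈ x, Literal.eval (fun v => !decide ((2 : ℤ) ∣ w v)) l = true := by
  by_contra hne
  push Not at hne
  have h' := stubParity_dvd_of_forall_eval_false w x fun l hl => by simpa using hne l hl
  omega

/-- The check-block coordinate `Σ_i u_i · [i ∈ scope x]` of a `3`-clause `x` over `N` variables is
the list sum of (any extension `g` of) `u` over the variables of `x`, these being distinct and
`< N`. (helper for stub `stub_parity`) -/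
theorem stubParity_sum_eq {N : ℕ} (u : Fin N → ℤ) (g : ℕ → ℤ) (hg : ∀ i : Fin N, g i = u i)
    {x : Clause ℕ} (hx : x ∈ kClauses 3 N) :
    (∑ i : Fin N, u i * (if (i : ℕ) ∈ clauseScope x then 1 else 0)) =
      (x.map fun l => g l.1).sum := by
  classical
  have hT := clauseScope_subset_range hx
  have hnd := nodup_map_fst_of_mem_kClauses hx
  calc (∑ i : Fin N, u i * (if (i : ℕ) ∈ clauseScope x then 1 else 0))
      = ∑ i : Fin N, (if (i : ℕ) ∈ clauseScope x then g i else 0) :=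
        Finset.sum_congr rfl fun i _ => by rw [hg i]; split_ifs <;> simp
    _ = ∑ v ∈ Finset.range N, (if v ∈ clauseScope x then g v else 0) :=
        Fin.sum_univ_eq_sum_range (fun v => if v ∈ clauseScope x then g v else 0) N
    _ = ∑ v ∈ clauseScope x, g v := by
        rw [Finset.sum_ite_mem, Finset.inter_eq_right.2 hT]
    _ = ((x.map Prod.fst).map g).sum := by rw [clauseScope, List.sum_toFinset g hnd]
    _ = (x.map fun l => g l.1).sum := by rw [List.map_map]; rfl

/-! ## The stub -/

/-- STUB `stub_parity` of line `Sketch` — "CNF-unsat ⇒ XOR-unsat" (Schoenebeck 2008, §5, from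
`k`-XOR to `k`-SAT): if some integer vector `u` passed every parity check
`Σ_i u_i · [i ∈ scope (C e)] ≡ rhsBit (C e) (mod 2)`, the parity assignment `σ v := [u_v odd]` would
make an odd number of literals — in particular at least one — of every clause `C e` true, hence
satisfy the CNF `List.ofFn C`. -/
theorem stub_parity {N me : ℕ} (C : Fin me → Clause ℕ) (hC : ∀ e, C e ∈ kClauses 3 N)
    (hunsat : ¬ CNF.Satisfiable (List.ofFn C)) : XorUnsat N me C := by
  intro u
  by_contra h
  push Not at h
  obtain ⟨g, hg⟩ : ∃ g : ℕ → ℤ, g = fun v => if hv : v < N then u ⟨v, hv⟩ else 0 := ⟨_, rfl⟩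
  have hgu : ∀ i : Fin N, g i = u i := fun i => by simp [hg, i.2]
  refine hunsat ⟨fun v => !decide ((2 : ℤ) ∣ g v), ?_⟩
  rw [CNF.eval_eq_true_iff]
  intro c hc
  obtain ⟨e, rfl⟩ := List.mem_ofFn.1 hc
  have h2 := h e
  rw [stubParity_sum_eq u g hgu (hC e)] at h2
  obtain ⟨l, hl, hl'⟩ := stubParity_exists_eval_true g (C e) h2
  exact List.any_eq_true.2 ⟨l, hl, hl'⟩

end Summit.PneNP.PneNP.Theorems.ConA
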